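import Literature.Analysis.FunctionSpaces.TorusAxisStepKernel
import Literature.Analysis.FunctionSpaces.TorusTrigPolyDifferences
import Literature.Analysis.FunctionSpaces.TorusMollifier
import Mathlib.Analysis.SpecialFunctions.ImproperIntegrals
import Mathlib.MeasureTheory.Integral.IntervalIntegral.Periodic
import Mathlib.Analysis.Real.Pi.Bounds
import HarnessLib

/-!
# The smoothed step kernel along one axis of `T^d`: the first-moment bound `∫ |yᵢ| |k(y)| dy ≤ 2/Δ`

Analysis/FunctionSpaces file (one definition — the centred coordinate of a point of the circle — and proofs; no
named facts).  Companion of `TorusAxisStepKernel` (the algebra of the smoothed step multiplier `stepSym K Δ` and its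
kernel `stepKernel i K Δ = Re(D_{K+Δ} |G_Δ|²)/Δ²`).  Here the ANALYSIS: from the geometric-sum bounds
`‖G_Δ(y)‖ · ‖e^{2πi yᵢ} − 1‖ ≤ 2`, `‖D_N(y)‖ · ‖e^{2πi yᵢ} − 1‖ ≤ 2` (`G_Δ (r − 1) = r^Δ − 1`) and Jordan's
inequality `‖e^{2πi yᵢ} − 1‖ ≥ 4 |yᵢ|` (`Torus.abs_reprc_apply_le_norm_charIncr`, `yᵢ = reprc y _i ∈ [−½, ½)`),
together with `‖G_Δ‖ ≤ Δ`, the pointwise majorant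

  `|reprc y _i| · |stepKernel i K Δ y| ≤ (1 + 4Δ² (reprc y _i)²)⁻¹`

(`abs_reprc_mul_abs_stepKernel_le`), and, integrating the one-coordinate majorant over the torus (marginal onto the
`i`-th circle, then the centred interval, then the line: `∫_ℝ (1 + 4Δ²x²)⁻¹ dx = π/(2Δ)`),

  `∫_{T^d} |reprc y _i| · |stepKernel i K Δ y| dy ≤ 2/Δ`     (`integral_abs_reprc_mul_abs_stepKernel_le`),

uniformly in the plateau length `K` — the commutator constant `‖[ψ(Dᵢ), β]‖ ≤ Lip(β)·M₁` of the multiplier with a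
Lipschitz function (DiPerna–Lions, Invent. Math. 98 (1989), §II.1 Lemma II.1; Grafakos, Classical Fourier Analysis,
§3.1.3 for the Dirichlet / Fejér kernels), free of the `log(K/Δ)` loss of product (cube) kernels.

Consumer: cell `ad-ideate`, K1L_D `stmt-AnomalousDissipation-27980`, W3-E (ii) `stub_effectiveFrameEnergyL_bandKill`
(cube cut-off ladder, finding F-k3l-7).

## Mathlib / tree search
Tree: `Torus.abs_reprc_apply_le_norm_charIncr` (Jordan), `Torus.reprc`, `Torus.measurable_reprc`, `TorusAxisStepKernel`.
Mathlib: `geom_sum_mul`, `MeasureTheory.measurePreserving_eval`, `UnitAddCircle.integral_preimage`,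
`AddCircle.equivIco_coe_of_mem`, `integral_univ_inv_one_add_sq`, `Measure.integral_comp_mul_left`, `Real.pi_lt_four`.

## References
* L. Grafakos, *Classical Fourier Analysis*, 3rd ed., GTM 249 (2014), §3.1.3, Prop. 3.1.2. [`Grafakos2014`]
* R. J. DiPerna, P.-L. Lions, Invent. Math. 98 (1989), §II.1 Lemma II.1. [`DiPernaLions1989`]
-/

noncomputable section

open MeasureTheory Set Filter Complex UnitAddTorus Function Finset
open scoped ENNReal InnerProductSpace ComplexConjugate

namespace Literature.Analysis.FunctionSpaces

namespace Torus

variable {d : Type*} [Fintype d] [DecidableEq d]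

/-! ## §6 Geometric-sum bounds, the pointwise majorant and the first moment -/

/-- `‖G_Δ(y)‖ ≤ Δ`. [cite: Grafakos2014, §3.1.3] -/
theorem norm_axisGeom_le (i : d) (Δ : ℕ) (y : UnitAddTorus d) : ‖axisGeom i Δ y‖ ≤ Δ := by
  unfold axisGeom
  refine (norm_sum_le _ _).trans ?_
  simp_rw [norm_mFourier_apply]
  simp

/-- The geometric-sum bound: `‖G_Δ(y)‖ · ‖e_{eᵢ}(y) − 1‖ ≤ 2` (`G_Δ (r − 1) = r^Δ − 1`). [cite: Grafakos2014, §3.1.3] -/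
theorem norm_axisGeom_mul_le (i : d) (Δ : ℕ) (y : UnitAddTorus d) :
    ‖axisGeom i Δ y‖ * ‖mFourier (Pi.single i 1) y - 1‖ ≤ 2 := by
  have h : axisGeom i Δ y * (mFourier (Pi.single i 1) y - 1) = mFourier (Pi.single i 1) y ^ Δ - 1 := by
    unfold axisGeom
    simp_rw [mFourier_single_natCast]
    exact geom_sum_mul _ _
  rw [← norm_mul, h]
  refine (norm_sub_le _ _).trans ?_
  rw [norm_pow, norm_mFourier_apply, one_pow, norm_one]
  norm_num

/-- The Dirichlet-sum bound: `‖D_N(y)‖ · ‖e_{eᵢ}(y) − 1‖ ≤ 2`. [cite: Grafakos2014, §3.1.3] -/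
theorem norm_axisDirichlet_mul_le (i : d) (N : ℕ) (y : UnitAddTorus d) :
    ‖axisDirichlet i N y‖ * ‖mFourier (Pi.single i 1) y - 1‖ ≤ 2 := by
  unfold axisDirichlet
  rw [norm_mul, norm_mFourier_apply, one_mul]
  exact norm_axisGeom_mul_le i (2 * N + 1) y

/-- **The pointwise majorant**: `|reprc y _i| · ‖k_C(y)‖ ≤ (1 + 4Δ² (reprc y _i)²)⁻¹` for `Δ ≥ 1`
(`|D|, |G| ≤ 1/(2|yᵢ|)` by Jordan, `|G| ≤ Δ`). [cite: Grafakos2014, §3.1.3] -/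
theorem abs_reprc_mul_norm_stepKernelC_le (i : d) (K : ℕ) {Δ : ℕ} (hΔ : 0 < Δ) (y : UnitAddTorus d) :
    |reprc y i| * ‖stepKernelC i K Δ y‖ ≤ (1 + 4 * (Δ : ℝ) ^ 2 * (reprc y i) ^ 2)⁻¹ := by
  set t : ℝ := |reprc y i| with ht
  have ht0 : 0 ≤ t := abs_nonneg _
  have hsq : (reprc y i) ^ 2 = t ^ 2 := by rw [ht, sq_abs]
  rw [hsq]
  have hden : 0 < 1 + 4 * (Δ : ℝ) ^ 2 * t ^ 2 := by positivity
  have hΔ2 : (0 : ℝ) < (Δ : ℝ) ^ 2 := by positivity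
  set G : ℝ := ‖axisGeom i Δ y‖ with hG
  set D : ℝ := ‖axisDirichlet i (K + Δ) y‖ with hD
  have hG0 : 0 ≤ G := norm_nonneg _
  have hD0 : 0 ≤ D := norm_nonneg _
  have hG1 : G ≤ Δ := norm_axisGeom_le i Δ y
  have hJ : 4 * t ≤ ‖mFourier (Pi.single i 1) y - 1‖ := by
    have := abs_reprc_apply_le_norm_charIncr y i; rw [← ht] at this; linarith
  have hG2 : G * (4 * t) ≤ 2 :=
    (mul_le_mul_of_nonneg_left hJ hG0).trans (norm_axisGeom_mul_le i Δ y)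
  have hD2 : D * (4 * t) ≤ 2 :=
    (mul_le_mul_of_nonneg_left hJ hD0).trans (norm_axisDirichlet_mul_le i (K + Δ) y)
  have hk : ‖stepKernelC i K Δ y‖ = D * G ^ 2 / (Δ : ℝ) ^ 2 := by
    unfold stepKernelC
    rw [norm_div, norm_mul, norm_mul, norm_pow, Complex.norm_natCast, Complex.norm_conj, ← hD, ← hG]
    ring
  rw [hk, inv_eq_one_div, le_div_iff₀ hden]
  -- `t D ≤ 1/2`, `G ≤ Δ`, `2 t G ≤ 1`
  have h1 : t * D ≤ 1 / 2 := by nlinarith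
  have h2 : G ^ 2 ≤ (Δ : ℝ) ^ 2 := pow_le_pow_left₀ hG0 hG1 2
  have h3 : (2 * t * G) ^ 2 ≤ 1 := by
    have : 2 * t * G ≤ 1 := by nlinarith
    have h0 : 0 ≤ 2 * t * G := by positivity
    nlinarith
  have key : (t * D) * (G ^ 2 + (Δ : ℝ) ^ 2 * (2 * t * G) ^ 2) ≤ (Δ : ℝ) ^ 2 :=
    calc (t * D) * (G ^ 2 + (Δ : ℝ) ^ 2 * (2 * t * G) ^ 2)
        ≤ (1 / 2) * ((Δ : ℝ) ^ 2 + (Δ : ℝ) ^ 2 * 1) := by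
          refine mul_le_mul h1 (add_le_add h2 (mul_le_mul_of_nonneg_left h3 hΔ2.le)) (by positivity) (by norm_num)
      _ = (Δ : ℝ) ^ 2 := by ring
  calc t * (D * G ^ 2 / (Δ : ℝ) ^ 2) * (1 + 4 * (Δ : ℝ) ^ 2 * t ^ 2)
      = (t * D) * (G ^ 2 + (Δ : ℝ) ^ 2 * (2 * t * G) ^ 2) / (Δ : ℝ) ^ 2 := by field_simp; ring
    _ ≤ (Δ : ℝ) ^ 2 / (Δ : ℝ) ^ 2 := div_le_div_of_nonneg_right key hΔ2.le
    _ = 1 := div_self hΔ2.ne'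

/-- The same majorant for the real kernel. [cite: Grafakos2014, §3.1.3] -/
theorem abs_reprc_mul_abs_stepKernel_le (i : d) (K : ℕ) {Δ : ℕ} (hΔ : 0 < Δ) (y : UnitAddTorus d) :
    |reprc y i| * |stepKernel i K Δ y| ≤ (1 + 4 * (Δ : ℝ) ^ 2 * (reprc y i) ^ 2)⁻¹ := by
  rw [← Real.norm_eq_abs (stepKernel i K Δ y), norm_stepKernel]
  exact abs_reprc_mul_norm_stepKernelC_le i K hΔ y

/-- The centred coordinate of a point of the circle: the representative of `s` in `[−1/2, 1/2)`. [cite: Grafakos2014, §3.1.1] -/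
def centredCoord (s : UnitAddCircle) : ℝ :=
  ((AddCircle.equivIco (1 : ℝ) (0 : ℝ) (s + (((1 / 2 : ℝ)) : UnitAddCircle)) : ℝ)) - 1 / 2

omit [Fintype d] [DecidableEq d] in
/-- The centred representative is coordinatewise the centred coordinate: `reprc y _i = centredCoord (y i)`.
[cite: Grafakos2014, §3.1.1] -/
theorem reprc_apply_eq_centredCoord (y : UnitAddTorus d) (i : d) : reprc y i = centredCoord (y i) := by
  rw [reprc, PiLp.sub_apply, repr_apply, cubeCenter_apply, centredCoord, Pi.add_apply, proj_apply, cubeCenter_apply]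

omit [Fintype d] [DecidableEq d] in
/-- On the open centred interval the centred coordinate of `↑x` is `x`. [cite: Grafakos2014, §3.1.1] -/
theorem centredCoord_coe {x : ℝ} (hx : x ∈ Ioo (-(1 / 2) : ℝ) (1 / 2)) : centredCoord (x : UnitAddCircle) = x := by
  rw [centredCoord, ← AddCircle.coe_add]
  have hmem : x + 1 / 2 ∈ Ico (0 : ℝ) (0 + 1) := by constructor <;> linarith [hx.1, hx.2]
  rw [AddCircle.equivIco_coe_of_mem hmem]
  ring

omit [Fintype d] [DecidableEq d] in
/-- The one-dimensional majorant integrates to at most `π/(2Δ)` over the circle: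
`∫_{𝕋¹} (1 + 4Δ² c(s)²)⁻¹ ds ≤ π/(2Δ)`. [cite: Grafakos2014, §3.1.3] -/
theorem integral_majorant_circle_le {Δ : ℕ} (hΔ : 0 < Δ) :
    ∫ s : UnitAddCircle, (1 + 4 * (Δ : ℝ) ^ 2 * (centredCoord s) ^ 2)⁻¹ ≤ Real.pi / (2 * Δ) := by
  have hΔ0 : (0 : ℝ) < Δ := by exact_mod_cast hΔ
  set g : ℝ → ℝ := fun x => (1 + 4 * (Δ : ℝ) ^ 2 * x ^ 2)⁻¹ with hg
  have hg0 : ∀ x, 0 ≤ g x := fun x => by rw [hg]; positivity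
  -- the line integral of the majorant
  have hline : ∫ x : ℝ, g x = Real.pi / (2 * Δ) := by
    have h := Measure.integral_comp_mul_left (fun u : ℝ => (1 + u ^ 2)⁻¹) (2 * (Δ : ℝ))
    have e : (fun x : ℝ => (1 + (2 * (Δ : ℝ) * x) ^ 2)⁻¹) = g := by
      funext x; rw [hg]; ring_nf
    rw [e, integral_univ_inv_one_add_sq] at h
    rw [h, smul_eq_mul, abs_of_pos (by positivity)]
    field_simp
  have hgi : Integrable g := by
    have h := integrable_inv_one_add_sq.comp_mul_left' (show (2 * (Δ : ℝ)) ≠ 0 by positivity)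
    refine h.congr (ae_of_all _ fun x => ?_)
    simp only [hg]
    ring_nf
  -- circle → interval
  have hpre := UnitAddCircle.integral_preimage (-(1 / 2) : ℝ) (fun s => (1 + 4 * (Δ : ℝ) ^ 2 * (centredCoord s) ^ 2)⁻¹)
  rw [← hpre]
  have hIoc : Ioc (-(1 / 2) : ℝ) (-(1 / 2) + 1) = Ioc (-(1 / 2) : ℝ) (1 / 2) := by norm_num
  rw [hIoc]
  -- on the open interval the integrand is `g`
  have hcongr : ∫ x in Ioc (-(1 / 2) : ℝ) (1 / 2), (1 + 4 * (Δ : ℝ) ^ 2 * (centredCoord (x : UnitAddCircle)) ^ 2)⁻¹ =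
      ∫ x in Ioc (-(1 / 2) : ℝ) (1 / 2), g x := by
    rw [setIntegral_congr_set Ioo_ae_eq_Ioc.symm, setIntegral_congr_set (s := Ioo _ _) (t := Ioc _ _) Ioo_ae_eq_Ioc |>.symm]
    refine setIntegral_congr_fun measurableSet_Ioo fun x hx => ?_
    rw [hg, centredCoord_coe hx]
  rw [hcongr, ← hline]
  exact setIntegral_le_integral hgi (ae_of_all _ hg0)

/-- The first-moment integrand `|reprc y _i| · |stepKernel i K Δ y|` is integrable (bounded and measurable). [cite: Grafakos2014, §3.1.3] -/
theorem integrable_abs_reprc_mul_abs_stepKernel (i : d) (K Δ : ℕ) :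
    Integrable (fun y : UnitAddTorus d => |reprc y i| * |stepKernel i K Δ y|) volume := by
  obtain ⟨C, hC⟩ := (isCompact_univ.image (continuous_stepKernel (d := d) i K Δ)).isBounded.exists_norm_le
  have hC' : ∀ y, |stepKernel i K Δ y| ≤ C := fun y => by
    rw [← Real.norm_eq_abs]; exact hC _ ⟨y, Set.mem_univ _, rfl⟩
  have h1 : Measurable fun y : UnitAddTorus d => reprc y i :=
    (EuclideanSpace.proj i : EuclideanSpace ℝ d →L[ℝ] ℝ).continuous.measurable.comp measurable_reprc
  refine Integrable.of_bound ((h1.norm).mul (continuous_stepKernel i K Δ).measurable.norm).aestronglyMeasurable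
    (1 / 2 * C) (ae_of_all _ fun y => ?_)
  rw [Real.norm_eq_abs, abs_mul, abs_abs, abs_abs]
  exact mul_le_mul (abs_reprc_apply_le y i) (hC' y) (abs_nonneg _) (by norm_num)

/-- **THE FIRST-MOMENT BOUND OF THE STEP KERNEL**: `∫_{T^d} |reprc y _i| · |stepKernel i K Δ y| dy ≤ 2/Δ`, uniformly in
the plateau `K` (`Δ ≥ 1`). [cite: Grafakos2014, §3.1.3] -/
theorem integral_abs_reprc_mul_abs_stepKernel_le (i : d) (K : ℕ) {Δ : ℕ} (hΔ : 0 < Δ) :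
    ∫ y : UnitAddTorus d, |reprc y i| * |stepKernel i K Δ y| ≤ 2 / Δ := by
  have hΔ0 : (0 : ℝ) < Δ := by exact_mod_cast hΔ
  set F : UnitAddCircle → ℝ := fun s => (1 + 4 * (Δ : ℝ) ^ 2 * (centredCoord s) ^ 2)⁻¹ with hF
  -- pointwise majorant, read through the `i`-th coordinate
  have hpt : ∀ y : UnitAddTorus d, |reprc y i| * |stepKernel i K Δ y| ≤ F (y i) := fun y => by
    rw [hF]; dsimp only; rw [← reprc_apply_eq_centredCoord]
    exact abs_reprc_mul_abs_stepKernel_le i K hΔ y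
  -- measurability / integrability
  have hmeasF : Measurable F := by
    have hc : Measurable centredCoord := by
      unfold centredCoord
      exact ((measurable_subtype_coe.comp (AddCircle.measurableEquivIco (1 : ℝ) 0).measurable).comp
        (measurable_id.add_const _)).sub_const _
    exact (measurable_const.add ((measurable_const.mul (hc.pow_const 2)))).inv
  have hFbd : ∀ s, |F s| ≤ 1 := fun s => by
    rw [hF]; dsimp only
    rw [abs_of_nonneg (by positivity)]
    exact inv_le_one_of_one_le₀ (by nlinarith [sq_nonneg (centredCoord s)])
  have hFi : Integrable (fun y : UnitAddTorus d => F (y i)) volume :=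
    Integrable.of_bound (hmeasF.comp (measurable_pi_apply i)).aestronglyMeasurable 1
      (ae_of_all _ fun y => by rw [Real.norm_eq_abs]; exact hFbd _)
  have hLi : Integrable (fun y : UnitAddTorus d => |reprc y i| * |stepKernel i K Δ y|) volume := by
    refine hFi.mono' ?_ (ae_of_all _ fun y => ?_)
    · have h1 : Measurable fun y : UnitAddTorus d => reprc y i :=
        (EuclideanSpace.proj i : EuclideanSpace ℝ d →L[ℝ] ℝ).continuous.measurable.comp measurable_reprc
      exact ((h1.norm).mul (continuous_stepKernel i K Δ).measurable.norm).aestronglyMeasurable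
    · rw [Real.norm_eq_abs, abs_of_nonneg (by positivity)]
      exact hpt y
  -- integrate, push to the circle, bound
  calc ∫ y : UnitAddTorus d, |reprc y i| * |stepKernel i K Δ y|
      ≤ ∫ y : UnitAddTorus d, F (y i) := integral_mono hLi hFi hpt
    _ = ∫ s : UnitAddCircle, F s := by
        have hmp := MeasureTheory.measurePreserving_eval (fun _ : d => (volume : Measure UnitAddCircle)) i
        rw [← MeasureTheory.volume_pi] at hmp
        rw [← hmp.map_eq, integral_map (measurable_pi_apply i).aemeasurable hmeasF.aestronglyMeasurable]
    _ ≤ Real.pi / (2 * Δ) := integral_majorant_circle_le hΔ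
    _ ≤ 2 / Δ := by
        rw [div_le_div_iff₀ (by positivity) hΔ0]
        nlinarith [Real.pi_lt_four, hΔ0]


end Torus

end Literature.Analysis.FunctionSpaces

end
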